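import Mathlib.Algebra.Algebra.ZMod
import Mathlib.Algebra.CharP.CharAndCard
import Mathlib.NumberTheory.Padics.HeightOneSpectrum
import Literature.NumberTheory.Automorphic.SerreConjecture
import Literature.NumberTheory.Automorphic.AdicCompletionResidueCard
import Literature.NumberTheory.GaloisRepresentations.InertiaRootsOfUnity
import HarnessLib

/-!
# Serre's modularity conjecture: the weak form from the strong form (proofs)

Sibling *proofs* file (theorems only: no definition, no named fact, no instance) of
`Literature.NumberTheory.Automorphic.SerreConjecture` (**lang.S37**).  That file states

* the strong form `SerreModularityConjecture p k` / named fact `khare_wintenberger p k`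
  (Serre, Duke Math. J. 54 (1987), (3.2.4): `ρ̄` arises from a newform of level `N(ρ̄)` and weight
  `k(ρ̄)`; theorem of Khare–Wintenberger, Invent. Math. 178 (2009), (I) Thm. 1.2 with (II), and
  Kisin, Invent. Math. 178 (2009) for the `2`-adic lifting hypothesis), and
* the weak form `exists_newform_of_odd_irreducible` (Serre, loc. cit., (3.2.3): `ρ̄` arises from
  *some* newform).

Here we PROVE that the weak form follows from the strong form,
`exists_newform_of_odd_irreducible_of_khare_wintenberger`, so that the named fact
`exists_newform_of_odd_irreducible` carries no mathematical debt beyond `khare_wintenberger`: its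
discharge `exists_newform_of_odd_irreducible_holds` is
`exists_newform_of_odd_irreducible_of_khare_wintenberger p k khare_wintenberger_holds` as soon as
the latter exists (SIZE XL: Khare–Wintenberger–Kisin needs Galois representations attached to
newforms, deformation theory, modularity lifting and potential modularity, none of which is in
Mathlib or in the tree).

The implication (3.2.4) ⇒ (3.2.3) is immediate *on paper*; in the tree it requires two
constructions which the strong form quantifies over and which this file supplies, for every prime
`p` and every `ρ̄ : Γ_ℚ → GL₂(k)`:

* `nonempty_localRestrictionAt` — a **local restriction datum at `p`**
  (`ModPGaloisRep.LocalRestrictionAt p ρ̄`, file `GaloisRepresentations/SerreWeight.lean`): the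
  completion `ℚ_v = v.adicCompletion ℚ` of `ℚ` at the place `v ↔ p`
  (`Rat.HeightOneSpectrum.primesEquiv`), which is a non-archimedean local field
  (`instIsNonarchimedeanLocalFieldAdicCompletion`, file `AdicCompletionLocalField.lean`) with
  residue field of cardinality `q_v = p` (`residueFieldCard_adicCompletion_eq`) in which `p` is a
  uniformiser (transported from Mathlib's `PadicInt.irreducible_p` along
  `Rat.HeightOneSpectrum.adicCompletionIntegers.padicIntEquiv : 𝒪_v ≃ ℤ_[p]`), together with the
  restriction `ρ̄|Γ_{ℚ_v}` (`FramedGaloisRep.restrictField`);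
* `nonempty_ringHom_residue` — a **residue embedding** `ι : S ⧸ 𝔓 →+* k` of the residue field
  of `\bar ℤ_p` (`absIntegers 𝒪[F] F ⧸ absMaximalIdeal F`, a union of finite fields:
  `exists_pow_residueFieldCard_pow_sub_mem`, file `InertiaRootsOfUnity.lean`) into any
  algebraically closed field `k` of characteristic `p` (Mathlib `IsAlgClosed.lift` over `𝔽_p`).

## References

* J.-P. Serre, *Sur les représentations modulaires de degré 2 de `Gal(ℚ̄/ℚ)`*, Duke Math. J. 54
  (1987), 179–230, §3.2, (3.2.3), (3.2.4). [Serre1987]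
* C. Khare, J.-P. Wintenberger, *Serre's modularity conjecture (I)*, Invent. Math. 178 (2009),
  485–504, Thm. 1.2. [KhareWintenberger2009]
* J.-P. Serre, *Local Fields*, GTM 67 (1979), Ch. II §4 (uniformisers, residue fields).
-/

noncomputable section

open scoped Classical
open CongruenceSubgroup ValuativeRel IsDedekindDomain NumberField

namespace Literature.NumberTheory.Automorphic

open EllipticCurves.ModularForms GaloisRepresentations GaloisRepresentations.ModPGaloisRep
  GaloisRepresentations.IsNonarchimedeanLocalField Rat.HeightOneSpectrum

universe v

/-! ### The place `v ↔ p` of `ℚ`: residue cardinality and uniformiser of `ℚ_v` -/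

section Place

variable (v : HeightOneSpectrum (𝓞 ℚ))

/-- `q_v = p` for the place `v` of `ℚ` above the rational prime `p = primesEquiv v`: the residue
ring `𝓞 ℚ ⧸ v ≃ ℤ ⧸ (p) ≃ ZMod p` has `p` elements.  (This is
`GaloisRepresentations.Rat.residueCard_eq_natGenerator` of `HeckeCharacterProofs.lean` and
`residueCard_eq_primesEquiv` of `Sweep1SymmetricPowerAdelic.lean`, reproved in five lines to keep
the imports of this file inside the local-field / Serre-conjecture cone.) [folklore] -/
private theorem residueCard_eq_coe_primesEquiv_aux :
    v.residueCard = ((primesEquiv v : Nat.Primes) : ℕ) := by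
  rw [v.residueCard_eq_card_quotient]
  have h : Ideal.span {(natGenerator v : ℤ)} =
      v.asIdeal.map (Rat.IsIntegralClosure.intEquiv (𝓞 ℚ) : 𝓞 ℚ →+* ℤ) :=
    span_natGenerator v
  rw [Nat.card_congr ((Ideal.quotientEquiv _ _ (Rat.IsIntegralClosure.intEquiv (𝓞 ℚ)) h).trans
    (Int.quotientSpanNatEquivZMod _)).toEquiv, Nat.card_zmod]
  rfl

/-- The valuation ring `𝒪[ℚ_v]` of the valuative relation of `ℚ_v = v.adicCompletion ℚ`
(`instValuativeRelAdicCompletion`, the relation of `Valued.v`) is, as a subring, Mathlib's ring of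
integers `𝒪_v = v.adicCompletionIntegers ℚ` (the valuation subring of `Valued.v`): the two
valuations are equivalent (`ValuativeRel.isEquiv`), so they have the same closed unit ball.
[folklore] -/
theorem valuativeInteger_adicCompletion_eq_toSubring :
    𝒪[v.adicCompletion ℚ] = (v.adicCompletionIntegers ℚ).toSubring := by
  ext x
  rw [Valuation.mem_integer_iff, ValuationSubring.mem_toSubring,
    HeightOneSpectrum.mem_adicCompletionIntegers]
  exact (ValuativeRel.isEquiv (valuation (v.adicCompletion ℚ))
      (Valued.v : Valuation (v.adicCompletion ℚ) _)).le_one_iff_le_one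

/-- **`p` is a uniformiser of `ℚ_v`** (`v ↔ p`): the rational prime `p = primesEquiv v` is an
irreducible element of the valuation ring `𝒪[ℚ_v]` of the valuative relation of
`ℚ_v = v.adicCompletion ℚ`.  Transported from Mathlib's `PadicInt.irreducible_p` (`p` is
irreducible in `ℤ_[p]`) along the ring isomorphisms
`ℤ_[p] ≃ v.adicCompletionIntegers ℚ` (`Rat.HeightOneSpectrum.adicCompletionIntegers.padicIntEquiv`)
and `v.adicCompletionIntegers ℚ ≃ 𝒪[ℚ_v]` (`valuativeInteger_adicCompletion_eq_toSubring`).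
Ref: Serre, *Local Fields*, Ch. II §4. [folklore] -/
theorem irreducible_natCast_valuativeInteger_adicCompletion :
    Irreducible (((primesEquiv v : Nat.Primes) : ℕ) : 𝒪[v.adicCompletion ℚ]) := by
  haveI : Fact (Nat.Prime (primesEquiv v : ℕ)) := ⟨(primesEquiv v).2⟩
  have h1 : Irreducible ((natGenerator v : ℕ) : v.adicCompletionIntegers ℚ) := by
    set e := (adicCompletionIntegers.padicIntEquiv v).toRingEquiv with he
    have h := PadicInt.irreducible_p (p := (primesEquiv v : ℕ))
    have key : e.symm ((primesEquiv v : ℕ) : ℤ_[(primesEquiv v : ℕ)]) =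
        ((natGenerator v : ℕ) : v.adicCompletionIntegers ℚ) := by
      rw [map_natCast]; rfl
    rw [← key]
    exact h.map e.symm
  have e' : (v.adicCompletionIntegers ℚ).toSubring ≃+* 𝒪[v.adicCompletion ℚ] :=
    RingEquiv.subringCongr (valuativeInteger_adicCompletion_eq_toSubring v).symm
  have h2 : Irreducible ((natGenerator v : ℕ) : (v.adicCompletionIntegers ℚ).toSubring) := h1
  have h3 := h2.map e'
  rwa [map_natCast] at h3

end Place

/-! ### Local restriction data at `p` and residue embeddings exist -/

section LocalData

variable {k : Type v} [Field k] [TopologicalSpace k]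

/-- **A local restriction datum at `p` exists** for every `ρ̄ : Γ_ℚ → GL₂(k)` and every prime
`p`: take `F = ℚ_v = v.adicCompletion ℚ` for the place `v = primesEquiv.symm p` of `ℚ` — a
non-archimedean local field (`instIsNonarchimedeanLocalFieldAdicCompletion`: Weil, *Basic Number
Theory*, Ch. III §1) with `q_F = q_v = p` (`residueFieldCard_adicCompletion_eq`) and uniformiser
`p` (`irreducible_natCast_valuativeInteger_adicCompletion`) — and `rep = ρ̄|Γ_{ℚ_v}`
(`FramedGaloisRep.restrictField`, along the tree's fixed `absGaloisRestrict ℚ ℚ_v`).  This is the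
datum `loc` over which the strong form `SerreModularityConjecture` quantifies (Serre, Duke Math.
J. 54 (1987), §2.1: "`G_p = Gal(ℚ̄_p/ℚ_p)` … choix d'une place de `ℚ̄` prolongeant `p`").
[folklore] -/
theorem nonempty_localRestrictionAt (p : ℕ) [Fact p.Prime] (ρ : ModPGaloisRep ℚ k 2) :
    Nonempty (LocalRestrictionAt p ρ) := by
  set v : HeightOneSpectrum (𝓞 ℚ) := (primesEquiv (R := 𝓞 ℚ)).symm ⟨p, Fact.out⟩ with hv
  have hpv : ((primesEquiv v : Nat.Primes) : ℕ) = p :=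
    congrArg Subtype.val ((primesEquiv (R := 𝓞 ℚ)).apply_symm_apply ⟨p, Fact.out⟩)
  refine ⟨{ F := v.adicCompletion ℚ
            residueFieldCard_eq := ?_
            irreducible_natCast := ?_
            rep := FramedGaloisRep.restrictField (v.adicCompletion ℚ) ρ
            rep_eq_restrictField := rfl }⟩
  · rw [residueFieldCard_adicCompletion_eq, residueCard_eq_coe_primesEquiv_aux, hpv]
  · have h := irreducible_natCast_valuativeInteger_adicCompletion v
    rwa [hpv] at h

omit [TopologicalSpace k] in
/-- **Residue embeddings exist.**  Let `F` be a non-archimedean local field with residue field of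
prime cardinality `p` and let `k` be an algebraically closed field of characteristic `p`.  Then
there is a ring homomorphism `ι : S ⧸ 𝔓 →+* k` from the residue field of the ring `S` of
integers of `F̄` at its prime `𝔓` (`absIntegers 𝒪[F] F ⧸ absMaximalIdeal F`, a field:
`absMaximalIdeal.isMaximal`).  Proof: `S ⧸ 𝔓` has characteristic `p` (it contains
`𝓀[F] = 𝔽_p`, `residueAlgebra`) and is algebraic over `𝔽_p` — every element satisfies
`x ^ (p ^ m) = x` for some `m ≥ 1` (`exists_pow_residueFieldCard_pow_sub_mem`: `S ⧸ 𝔓` is a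
union of finite fields, Serre, *Local Fields*, Ch. IV §4, Cor. 2 to Prop. 16) — so Mathlib's
`IsAlgClosed.lift` over `ZMod p` applies.  (In fact `S ⧸ 𝔓 ≅ 𝔽̄_p`; only the embedding is
needed.) [folklore] -/
theorem nonempty_ringHom_residue (p : ℕ) [Fact p.Prime] [CharP k p] [IsAlgClosed k]
    (F : Type) [Field F] [ValuativeRel F] [TopologicalSpace F] [IsNonarchimedeanLocalField F]
    (hF : residueFieldCard F = p) :
    Nonempty (absIntegers 𝒪[F] F ⧸ absMaximalIdeal F →+* k) := by
  letI : Field (absIntegers 𝒪[F] F ⧸ absMaximalIdeal F) := Ideal.Quotient.field _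
  -- the residue fields `𝓀[F]` and `S ⧸ 𝔓` have characteristic `p`
  haveI : Fintype 𝓀[F] := Fintype.ofFinite _
  have hcard : Fintype.card 𝓀[F] = p := by rw [Fintype.card_eq_nat_card]; exact hF
  haveI : CharP 𝓀[F] p := charP_of_card_eq_prime hcard
  haveI : CharP (absIntegers 𝒪[F] F ⧸ absMaximalIdeal F) p :=
    ((algebraMap 𝓀[F] (absIntegers 𝒪[F] F ⧸ absMaximalIdeal F)).charP_iff_charP p).mp
      inferInstance
  letI : Algebra (ZMod p) (absIntegers 𝒪[F] F ⧸ absMaximalIdeal F) := ZMod.algebra _ p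
  letI : Algebra (ZMod p) k := ZMod.algebra _ p
  -- `S ⧸ 𝔓` is algebraic over `𝔽_p`: `x ^ (p ^ m) = x`
  haveI : Algebra.IsAlgebraic (ZMod p) (absIntegers 𝒪[F] F ⧸ absMaximalIdeal F) := by
    refine ⟨fun x => ?_⟩
    obtain ⟨b, rfl⟩ := Ideal.Quotient.mk_surjective x
    obtain ⟨m, hm, hbm⟩ := exists_pow_residueFieldCard_pow_sub_mem b
    refine ⟨Polynomial.X ^ p ^ m - Polynomial.X, ?_, ?_⟩
    · exact FiniteField.X_pow_card_pow_sub_X_ne_zero (ZMod p) hm.ne' (Fact.out : p.Prime).one_lt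
    · have h := (Ideal.Quotient.eq_zero_iff_mem).mpr hbm
      rw [hF] at h
      simpa [map_sub, map_pow] using h
  -- vector spaces are torsion-free (stated by hand: the generic instances are not found in time)
  haveI : Module.IsTorsionFree (ZMod p) (absIntegers 𝒪[F] F ⧸ absMaximalIdeal F) :=
    .of_smul_eq_zero fun r m h => by
      by_cases hr : r = 0
      · exact Or.inl hr
      · exact Or.inr (by rw [← inv_smul_smul₀ hr m, h, smul_zero])
  haveI : Module.IsTorsionFree (ZMod p) k :=
    .of_smul_eq_zero fun r m h => by
      by_cases hr : r = 0
      · exact Or.inl hr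
      · exact Or.inr (by rw [← inv_smul_smul₀ hr m, h, smul_zero])
  exact ⟨(IsAlgClosed.lift (R := ZMod p) (M := k)
    (S := absIntegers 𝒪[F] F ⧸ absMaximalIdeal F)).toRingHom⟩

end LocalData

/-! ### The weak form of Serre's conjecture from the strong form -/

section WeakFromStrong

variable (p : ℕ) [Fact p.Prime] (k : Type v) [Field k] [TopologicalSpace k] [DiscreteTopology k]

/-- **Serre's conjecture, weak form (3.2.3), from the strong form (3.2.4).**  If every continuous,
irreducible, odd `ρ̄ : Γ_ℚ → GL₂(k)` (`k` algebraically closed of characteristic `p`) arises from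
a newform of level `N(ρ̄)` and weight `k(ρ̄)` (`SerreModularityConjecture p k`), then every such
`ρ̄` arises from some newform (`exists_newform_of_odd_irreducible`): instantiate the strong form at
a local restriction datum at `p` (`nonempty_localRestrictionAt`) and a residue embedding
(`nonempty_ringHom_residue`), and take `N = N(ρ̄)` (nonzero: `ModPGaloisRep.not_dvd_serreLevel`),
`w = k(ρ̄)`; the exceptional sets `{q ∣ N p}` agree literally.  Serre, Duke Math. J. 54 (1987),
§3.2 ((3.2.4) refines (3.2.3)). [cite: Serre1987, §3.2, (3.2.3)–(3.2.4)] -/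
theorem exists_newform_of_odd_irreducible_of_serreModularityConjecture
    (h : SerreModularityConjecture p k) :
    exists_newform_of_odd_irreducible (p := p) (k := k) := by
  intro _ _ ρ hirr hodd
  obtain ⟨loc⟩ := nonempty_localRestrictionAt p ρ
  obtain ⟨ι⟩ := nonempty_ringHom_residue (k := k) p loc.F loc.residueFieldCard_eq
  obtain ⟨f, ιf, hf, hρ⟩ := h ρ hirr hodd loc ι
  exact ⟨serreLevel p ρ, _, serreWeight p ρ loc ι, f, ιf, hf, hρ⟩

/-- **The weak form of Serre's conjecture from the Khare–Wintenberger theorem (as vendored).**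
The named fact `exists_newform_of_odd_irreducible` (Serre (3.2.3); Khare–Wintenberger, Invent.
Math. 178 (2009), Thm. 1.2) follows from the named fact `khare_wintenberger p k` (the strong form
(3.2.4), loc. cit.).  Hence the discharge `exists_newform_of_odd_irreducible_holds` is this
theorem applied to `khare_wintenberger_holds`, once that (SIZE XL) discharge exists; no other
mathematics is owed by the weak form.
[cite: KhareWintenberger2009, Thm. 1.2 (with Serre, Duke Math. J. 54 (1987), (3.2.3)–(3.2.4))] -/
theorem exists_newform_of_odd_irreducible_of_khare_wintenberger (h : khare_wintenberger p k) :
    exists_newform_of_odd_irreducible (p := p) (k := k) :=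
  exists_newform_of_odd_irreducible_of_serreModularityConjecture p k h

/-- **Assembly of the split of `exists_newform_of_odd_irreducible`** (lang.S37, weak form of
Serre's conjecture; budget-capped fact, librarian `fact-decompose`, human ruling 2026-08-16). The
printed theorems (Khare–Wintenberger (I), Thm. 1.2 and Thm. 9.1, with Kisin's Thm. 0.1 / Cor. 0.2
as Hypothesis (H)) prove the STRONG form (3.2.4) — the tree's named fact `khare_wintenberger p k`
— and the weak form (3.2.3) is read off it (Serre 1987, §3.2: (3.2.4) refines (3.2.3)); the
weak form has no proof of its own in print (conversely, by Ribet–Edixhoven level lowering and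
weight optimisation it gives (3.2.4) back for `p > 2`). So the single child of the split is
`khare_wintenberger p k`, and the glue is `exists_newform_of_odd_irreducible_of_khare_wintenberger`.
[cite: KhareWintenberger2009, Thm. 1.2 and Thm. 9.1 (with Serre, Duke Math. J. 54 (1987), (3.2.3)–(3.2.4))]
[cite: Kisin2009TwoAdic, Thm. 0.1, Cor. 0.2] -/
theorem exists_newform_of_odd_irreducible_holds_of :
    khare_wintenberger p k → exists_newform_of_odd_irreducible (p := p) (k := k) :=
  fun h => exists_newform_of_odd_irreducible_of_khare_wintenberger p k h

end WeakFromStrong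

end Literature.NumberTheory.Automorphic
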